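import Mathlib

/-!
# The norm space of the class `c_new = cl(√3 − 1)` of `ℚ(ζ₁₂)` is anisotropic
(P2-MoonenClasses-v2 v1.2 §4, candidate D6 «REACH-AND-REDUCTION» (R1″); seat p2, pub-hodge-repro0)

For a `ℚ(ζ₁₂)`-fourfold `D` of signature `((2,0),(1,1))` with hermitian class `c`, the rational quadratic space of
`det_K H¹(D)` (= `T(Ỹ) ⊗ ℚ` for any K3 model) is the norm space `Q_c(x) = Tr_{K⁺/ℚ}(c · x · x̄)` on `K = ℚ(ζ₁₂)`.
For `c = √3 − 1` the Gram matrix in the basis `1, ζ, ζ², ζ³` (PARI, p2-scripts/qfsolve_classes.gp) is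
`G = [[−4, 6, −2, 0], [6, −4, 6, −2], [−2, 6, −4, 6], [0, −2, 6, −4]]`, i.e. `Q_c = −4·q` with
`q(a,b,c,d) = a² + b² + c² + d² − 3ab + ac − 3bc + bd − 3cd`. The theorem below: `q` has no non-zero integer zero
(3-adic descent: `q ≡ (a−c)² + (b−d)² (mod 3)` and `q(a, b, a+3s, b+3t) = 3(a² + b²) + 9(…)`); by homogeneity `Q_c` has
no non-zero rational zero, so the transcendental lattice of every K3 model of `c_new` contains no isotropic vector — no
hyperbolic plane `U`, no Shioda–Inose structure (Morrison Thm 6.3 / Cor 6.4(ii)). For comparison, `Q_{2√3}(1) = Tr(2√3) = 0`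
is isotropic (row (20)).
-/

namespace HodgeRepro0.AnisotropicClassZeta12

/-- the integral form `q = −Q_{√3−1}/4` in the basis `1, ζ, ζ², ζ³` of `ℚ(ζ₁₂)` -/
def q (a b c d : ℤ) : ℤ := a ^ 2 + b ^ 2 + c ^ 2 + d ^ 2 - 3 * a * b + a * c - 3 * b * c + b * d - 3 * c * d

/-- a square is `0` or `1` modulo `3` -/
lemma sq_emod_three (x : ℤ) : x ^ 2 % 3 = 0 ∨ x ^ 2 % 3 = 1 := by
  have h0 : 0 ≤ x % 3 := Int.emod_nonneg x (by norm_num)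
  have h3 : x % 3 < 3 := Int.emod_lt_of_pos x (by norm_num)
  have : x ^ 2 % 3 = (x % 3) * (x % 3) % 3 := by rw [pow_two, Int.mul_emod]
  rw [this]
  interval_cases (x % 3) <;> simp

/-- if `3 ∣ b² + u²` then `3 ∣ b` and `3 ∣ u` -/
lemma three_dvd_of_sq_add_sq {b u : ℤ} (h : (3 : ℤ) ∣ b ^ 2 + u ^ 2) : 3 ∣ b ∧ 3 ∣ u := by
  have hb := sq_emod_three b
  have hu := sq_emod_three u
  have hsum : (b ^ 2 + u ^ 2) % 3 = 0 := Int.emod_eq_zero_of_dvd h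
  have hadd : (b ^ 2 + u ^ 2) % 3 = ((b ^ 2 % 3) + (u ^ 2 % 3)) % 3 := Int.add_emod _ _ _
  have hb0 : b ^ 2 % 3 = 0 := by omega
  have hu0 : u ^ 2 % 3 = 0 := by omega
  exact ⟨Int.prime_three.dvd_of_dvd_pow (Int.dvd_of_emod_eq_zero hb0),
         Int.prime_three.dvd_of_dvd_pow (Int.dvd_of_emod_eq_zero hu0)⟩

/-- `q ≡ (a − c)² + (b − d)²  (mod 3)` -/
lemma q_sub_squares (a b c d : ℤ) :
    q a b c d - ((a - c) ^ 2 + (b - d) ^ 2) = 3 * (-a * b + a * c - b * c + b * d - c * d) := by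
  unfold q; ring

/-- `q(a, b, a + 3s, b + 3t) = 3(a² + b²) + 9(…)` -/
lemma q_shift (a b s t : ℤ) :
    q a b (a + 3 * s) (b + 3 * t)
      = 3 * (a ^ 2 + b ^ 2) + 9 * (-a * b + a * s - a * t - 2 * b * s + b * t + s ^ 2 + t ^ 2 - 3 * s * t) := by
  unfold q; ring

/-- `q` is homogeneous of degree `2` -/
lemma q_three_mul (a b c d : ℤ) : q (3 * a) (3 * b) (3 * c) (3 * d) = 9 * q a b c d := by
  unfold q; ring

/-- descent: every integer zero of `q` with `|a| + |b| + |c| + |d| ≤ n` is the zero vector -/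
lemma descent (n : ℕ) : ∀ a b c d : ℤ, a.natAbs + b.natAbs + c.natAbs + d.natAbs ≤ n →
    q a b c d = 0 → a = 0 ∧ b = 0 ∧ c = 0 ∧ d = 0 := by
  induction n with
  | zero =>
    intro a b c d hn _
    have ha : a.natAbs = 0 := by omega
    have hb : b.natAbs = 0 := by omega
    have hc : c.natAbs = 0 := by omega
    have hd : d.natAbs = 0 := by omega
    exact ⟨Int.natAbs_eq_zero.mp ha, Int.natAbs_eq_zero.mp hb, Int.natAbs_eq_zero.mp hc, Int.natAbs_eq_zero.mp hd⟩
  | succ n ih =>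
    intro a b c d hn h
    -- step 1: `3 ∣ (a − c)² + (b − d)²`, hence `c = a + 3s`, `d = b + 3t`
    have h1 : (3 : ℤ) ∣ (a - c) ^ 2 + (b - d) ^ 2 := by
      refine ⟨-(-a * b + a * c - b * c + b * d - c * d), ?_⟩
      have := q_sub_squares a b c d
      linarith
    obtain ⟨⟨s, hs⟩, ⟨t, ht⟩⟩ := three_dvd_of_sq_add_sq h1
    have hc : c = a + 3 * (-s) := by linarith
    have hd : d = b + 3 * (-t) := by linarith
    subst hc hd
    -- step 2: `3 ∣ a² + b²`, hence `3 ∣ a`, `3 ∣ b`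
    have h2 : (3 : ℤ) ∣ a ^ 2 + b ^ 2 := by
      refine ⟨-(-a * b + a * (-s) - a * (-t) - 2 * b * (-s) + b * (-t) + (-s) ^ 2 + (-t) ^ 2 - 3 * (-s) * (-t)), ?_⟩
      have := q_shift a b (-s) (-t)
      linarith
    obtain ⟨⟨a', rfl⟩, ⟨b', rfl⟩⟩ := three_dvd_of_sq_add_sq h2
    -- the same equation for the vector divided by `3`
    have hc' : 3 * a' + 3 * (-s) = 3 * (a' - s) := by ring
    have hd' : 3 * b' + 3 * (-t) = 3 * (b' - t) := by ring
    rw [hc', hd'] at h hn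
    rw [q_three_mul] at h
    have h' : q a' b' (a' - s) (b' - t) = 0 := by omega
    have hsize : a'.natAbs + b'.natAbs + (a' - s).natAbs + (b' - t).natAbs ≤ n := by
      rw [Int.natAbs_mul, Int.natAbs_mul, Int.natAbs_mul, Int.natAbs_mul] at hn
      simp only [Int.reduceAbs] at hn
      omega
    obtain ⟨ha', hb', hc'', hd''⟩ := ih a' b' (a' - s) (b' - t) hsize h'
    subst ha' hb'
    refine ⟨by ring, by ring, ?_, ?_⟩
    · rw [hc']; simp [hc'']
    · rw [hd']; simp [hd'']

/-- the norm space of `c_new = cl(√3 − 1)` is anisotropic: `q(a,b,c,d) = 0` forces `a = b = c = d = 0` -/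
theorem anisotropic (a b c d : ℤ) (h : q a b c d = 0) : a = 0 ∧ b = 0 ∧ c = 0 ∧ d = 0 :=
  descent _ a b c d le_rfl h

/-- restated with the Gram matrix of `Q_{√3−1}` (`Q = −4q`): no non-zero integer isotropic vector -/
theorem no_isotropic_vector (a b c d : ℤ) (hne : ¬ (a = 0 ∧ b = 0 ∧ c = 0 ∧ d = 0)) :
    -4 * a ^ 2 - 4 * b ^ 2 - 4 * c ^ 2 - 4 * d ^ 2 + 12 * a * b - 4 * a * c + 12 * b * c - 4 * b * d + 12 * c * d ≠ 0 := by
  intro h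
  apply hne
  apply anisotropic
  unfold q
  linarith

end HodgeRepro0.AnisotropicClassZeta12
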